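import Summits.Ventures.LatticeQCDFlow.Exactness.IMHAcceptanceWeightOrder
import HarnessLib

/-!
# The exact flow sampler's equilibrium acceptance is SYMMETRIC under model ↔ target:
# `∫ w(x) ∫ α_{w,q̃}(x,y) q̃(y) = ∫ q̃(x) ∫ α_{q̃,w}(x,y) w(y)` for any positive integrable `w`, `q̃`

HONEST FRAMING: exact (Metropolis-corrected) sampling algorithms for lattice gauge theory;
figures of merit are autocorrelation/cost numbers at stated couplings and volumes; no
continuum-physics claim.  (SCALAR calibration rung S0-A: not a gauge result.)

Venture `LatticeQCDFlow` (cell pub-lqcd), topic `Exactness`; FANOUT row 2 (`s0-phi4`, FLOW arm).  NEW WORK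
of the cell, a corollary of row 2's `IMHAcceptanceWeightOrder.imh_meanAccept_eq_integral_swap` (the
equilibrium acceptance of the independence Metropolis–Hastings / exact flow sampler is the involutive
acceptance `∫ min(1, e^{−ΔH}) e^{−H}` of the SWAP on `X × X`, `H(x,y) = −log w(x) − log q̃(y)`): the
integrand `min(e^{−H(x,y)}, e^{−H(y,x)}) = min(w(x)q̃(y), w(y)q̃(x))` is unchanged when the roles of the
target weight `w` and the model `q̃` are exchanged, hence so is the acceptance integral — for EVERY
positive integrable pair, on any s-finite measure space.  (For Gaussians this is the `s ↔ t` symmetry of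
`GaussianFlowModeAcceptance` and the `μ ↔ −μ`-free form of `GaussianFlowShiftAcceptance`; here it is
model-free.)  Nothing is cited; no definition.

## What is proved (`w q̃ : X → ℝ` positive, measurable, integrable w.r.t. an s-finite `μ`)

* `imh_acceptIntegrand_symm` — pointwise: `min(1, e^{−ΔH_{w,q̃}}) e^{−H_{w,q̃}} = min(1, e^{−ΔH_{q̃,w}}) e^{−H_{q̃,w}}`
  at every `(x, y)` (both equal `min(w(x)q̃(y), w(y)q̃(x))`);
* **`imh_meanAccept_symm`** — `∫ w(x) (∫ imhAcceptQ w q̃ x y · q̃(y)) = ∫ q̃(x) (∫ imhAcceptQ q̃ w x y · w(y))`: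
  the un-normalised equilibrium acceptance of the sampler with target `w dμ/Z` and model `q̃ dμ` equals
  that of the sampler with target `q̃ dμ` and model `w dμ/Z` (after dividing both by `Z = ∫ w`, with
  `∫ q̃ = 1`: `ā(w → q̃) = ā(q̃ → w)`).

Reading for S0-A: a flow that is too WIDE by a factor is accepted exactly as often as one too NARROW by the
same factor only in the Gaussian case; what holds in general is the exchange symmetry above — the
acceptance column cannot tell which of the two densities is the model.  NOT CLAIMED: anything about
`τ_int` (NOT symmetric: the chain with the heavier-tailed target behaves differently), nor about values.
-/

namespace Summit.Ventures.LatticeQCDFlow.Exactness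

open Real MeasureTheory ProbabilityTheory Filter Set

section Pointwise

variable {X : Type*} {w q : X → ℝ}

/-- Pointwise symmetry of the involutive acceptance integrand of the swap under `w ↔ q̃`:
both sides equal `min(w(x) q̃(y), w(y) q̃(x))`. -/
theorem imh_acceptIntegrand_symm (hw0 : ∀ t, 0 < w t) (hq0 : ∀ t, 0 < q t) (z : X × X) :
    min 1 (Real.exp (-deltaH (fun z : X × X => -Real.log (w z.1) - Real.log (q z.2)) Prod.swap z))
        * Real.exp (-(-Real.log (w z.1) - Real.log (q z.2)))
      = min 1 (Real.exp (-deltaH (fun z : X × X => -Real.log (q z.1) - Real.log (w z.2)) Prod.swap z))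
        * Real.exp (-(-Real.log (q z.1) - Real.log (w z.2))) := by
  -- both sides are `min(e^{−H(z)}, e^{−H(swap z)})` with the two energies exchanged by the swap
  have key : ∀ (f g : X → ℝ), (∀ t, 0 < f t) → (∀ t, 0 < g t) →
      min 1 (Real.exp (-deltaH (fun z : X × X => -Real.log (f z.1) - Real.log (g z.2)) Prod.swap z))
        * Real.exp (-(-Real.log (f z.1) - Real.log (g z.2))) = min (f z.1 * g z.2) (f z.2 * g z.1) := by
    intro f g hf hg
    have hpos : 0 < f z.1 * g z.2 := mul_pos (hf _) (hg _)
    rw [swapEnergy_exp_neg hf hg z]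
    unfold deltaH
    simp only [Prod.fst_swap, Prod.snd_swap]
    rw [show -(-Real.log (f z.2) - Real.log (g z.1) - (-Real.log (f z.1) - Real.log (g z.2)))
        = (Real.log (f z.2) + Real.log (g z.1)) - (Real.log (f z.1) + Real.log (g z.2)) by ring,
      Real.exp_sub, ← Real.log_mul (hf _).ne' (hg _).ne', ← Real.log_mul (hf _).ne' (hg _).ne',
      Real.exp_log (mul_pos (hf _) (hg _)), Real.exp_log hpos, min_mul_of_nonneg _ _ hpos.le, one_mul,
      div_mul_cancel₀ _ hpos.ne']
  rw [key w q hw0 hq0, key q w hq0 hw0, min_comm]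
  congr 1 <;> ring

end Pointwise

section Symmetry

variable {X : Type*} [MeasurableSpace X] {μ : Measure X} [SFinite μ] {w q : X → ℝ}

/-- **MODEL ↔ TARGET SYMMETRY OF THE EQUILIBRIUM ACCEPTANCE** of the exact flow sampler /
independence Metropolis–Hastings chain: `∫ w(x) ∫ α_{w,q̃}(x,y) q̃(y) dμ dμ = ∫ q̃(x) ∫ α_{q̃,w}(x,y) w(y) dμ dμ`. -/
theorem imh_meanAccept_symm (hw0 : ∀ t, 0 < w t) (hwm : Measurable w) (hwi : Integrable w μ)
    (hq0 : ∀ t, 0 < q t) (hqm : Measurable q) (hqi : Integrable q μ) :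
    ∫ x, w x * (∫ y, imhAcceptQ w q x y * q y ∂μ) ∂μ
      = ∫ x, q x * (∫ y, imhAcceptQ q w x y * w y ∂μ) ∂μ := by
  rw [imh_meanAccept_eq_integral_swap hw0 hwm hwi hq0 hqm hqi,
    imh_meanAccept_eq_integral_swap hq0 hqm hqi hw0 hwm hwi]
  congr 1
  funext z
  exact imh_acceptIntegrand_symm hw0 hq0 z

end Symmetry

end Summit.Ventures.LatticeQCDFlow.Exactness
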